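import Summits.BirchSwinnertonDyer.BirchSwinnertonDyer.Theorems.ResidualThetaTransportAtTwoSignedMuSeedAtTwoPlusSmoothingCoboundaryMahler
import HarnessLib

/-!
# Smoothing coboundary VI — precision bookkeeping: `η·G∘s − G (mod Tᴺ)` depends only on `G (mod Tᴺ)` and `s (mod Tᴺ)`
# (card (D): «`G_χ∘[u] ≡ η(β)⁻¹(G_χ + Φ_β) (mod T^{4^k})` for `[β] ≡ [u]` to order `4^k`»; CS6 `EngineTransfer`: «`NonDeg(m; χ, 𝔩)`
# is a function of (`G_χ mod T^{N_m}`, `η(π_𝔩)`, `[π_𝔩] mod T^{N_m}`)»)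
# (seed crux `SignedMuSeedAtTwoPlus` stmt-BirchSwinnertonDyer-21438; parent Kμ⁺ stmt-BirchSwinnertonDyer-20689, route
# ResidualThetaTransportAtTwo; line card `Cruxes/SignedMuSeedAtTwoPlus/Lines/smoothing-coboundary.md`)

Cell `bsd-wall`, width seat `bsd-wall-rtt-p4-w2` g15 (`--supports`, closes nothing).  THEOREMS ONLY; BSD is not proved by this.

* `coeff_pow_congr` — power series agreeing up to degree `m` have powers agreeing up to degree `m`;
* **`coeff_subst_congr`** — for substitution series `s, s'` with zero constant term agreeing up to degree `n` and `G, G'`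
  agreeing up to degree `n`: `[Tⁿ](G∘s) = [Tⁿ](G'∘s')`;
* **`twistSubst_congr_mod`** — hence `η·G∘s − G ≡ η·G'∘s' − G' (mod Tᴺ)` when `G ≡ G'`, `s ≡ s'` `(mod Tᴺ)`: the
  algebraic half of CS6 (the engine's input `F°_π = (η(π)[π]^* − 1)G_χ mod Tᴺ` is a function of `G_χ mod Tᴺ`, `η(π)`,
  `[π] mod Tᴺ`); with `…Mahler.mahler_congr_mod` the dependence on `G mod Tᴺ` is exactly faithful;
* **`mahler_translate_congr_mod`** — if `η·G∘s − G = Φ` and `s' ≡ s (mod Tᴺ)` then `η·G∘s' ≡ G + Φ (mod Tᴺ)`: the card's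
  «every `ℤ₄ˣ`-translate of the class series is affine in `G_χ` modulo `Tᴺ`», given `[β] ≡ [u] (mod Tᴺ)` (a formal-group
  fact not proved here).

[folklore]
-/

noncomputable section

set_option autoImplicit false
-- the Theorems namespace of this sub repeats the summit name by design (D-0017 nested layout)
set_option linter.dupNamespace false

open PowerSeries Finset

namespace Summit.BirchSwinnertonDyer.BirchSwinnertonDyer.Theorems.SignedMuAtTwo.SmoothingCoboundary

variable {k : Type*} [CommRing k]

/-- Power series agreeing up to degree `m` have all powers agreeing up to degree `m`. [folklore] -/
theorem coeff_pow_congr {t t' : PowerSeries k} {m : ℕ} (h : ∀ i ≤ m, coeff i t = coeff i t') (d : ℕ) :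
    ∀ i ≤ m, coeff i (t ^ d) = coeff i (t' ^ d) := by
  induction d with
  | zero => intro i _; rw [pow_zero, pow_zero]
  | succ d ih =>
    intro i hi
    rw [pow_succ, pow_succ, coeff_mul, coeff_mul]
    refine sum_congr rfl fun p hp => ?_
    have hp' := mem_antidiagonal.mp hp
    rw [ih p.1 (by omega), h p.2 (by omega)]

/-- A substitution series with zero constant term is `T·t`, and agreement of two such up to degree `n` is agreement of
the quotients up to degree `n − 1`. [folklore] -/
theorem coeff_divX_congr {t t' : PowerSeries k} {n : ℕ} (h : ∀ i ≤ n, coeff i (X * t) = coeff i (X * t')) :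
    ∀ i, i + 1 ≤ n → coeff i t = coeff i t' := by
  intro i hi
  have := h (i + 1) hi
  rwa [coeff_succ_X_mul, coeff_succ_X_mul] at this

/-- **Substitution respects precision**: for `s, s'` with zero constant term agreeing up to degree `n`, and `G, G'`
agreeing up to degree `n`, `[Tⁿ](G∘s) = [Tⁿ](G'∘s')`. [folklore] -/
theorem coeff_subst_congr {s s' G G' : PowerSeries k} (hs0 : constantCoeff s = 0) (hs0' : constantCoeff s' = 0)
    {n : ℕ} (hs : ∀ i ≤ n, coeff i s = coeff i s') (hG : ∀ i ≤ n, coeff i G = coeff i G') :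
    coeff n (G.subst s) = coeff n (G'.subst s') := by
  obtain ⟨t, rfl⟩ := X_dvd_iff.mpr hs0
  obtain ⟨t', rfl⟩ := X_dvd_iff.mpr hs0'
  rw [coeff_subst_X_mul, coeff_subst_X_mul]
  refine sum_congr rfl fun d hd => ?_
  have hdn : d ≤ n := Nat.lt_succ_iff.mp (mem_range.mp hd)
  rw [hG d hdn]
  rcases Nat.eq_zero_or_pos d with rfl | hd0
  · rw [pow_zero, pow_zero]
  · rw [coeff_pow_congr (m := n - 1) (fun i hi => coeff_divX_congr hs i (by omega)) d (n - d) (by omega)]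

/-- **The twisted substitution operator respects precision** (CS6, algebraic half): `G ≡ G' (mod Tᴺ)` and
`s ≡ s' (mod Tᴺ)` (zero constant terms) ⟹ `η·G∘s − G ≡ η·G'∘s' − G' (mod Tᴺ)`. [folklore] -/
theorem twistSubst_congr_mod (η : k) {s s' G G' : PowerSeries k} (hs0 : constantCoeff s = 0)
    (hs0' : constantCoeff s' = 0) {N : ℕ} (hs : ∀ i < N, coeff i s = coeff i s') (hG : ∀ i < N, coeff i G = coeff i G') :
    ∀ n < N, coeff n (η • G.subst s - G) = coeff n (η • G'.subst s' - G') := by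
  intro n hn
  rw [map_sub, map_sub, map_smul, map_smul, hG n hn,
    coeff_subst_congr hs0 hs0' (fun i hi => hs i (by omega)) (fun i hi => hG i (by omega))]

/-- **Translates of the class series are affine in it, precision by precision** (card (D)): if `η·G∘s − G = Φ` and
`s' ≡ s (mod Tᴺ)` (zero constant terms) then `η·G∘s' ≡ G + Φ (mod Tᴺ)`. In the card: `s = [β]`, `s' = [u]`, `u ∈ ℤ₄ˣ`,
`β ≡ u (mod 2^k)`, `N = 4^k`. [folklore] -/
theorem mahler_translate_congr_mod (η : k) {s s' G Φ : PowerSeries k} (hs0 : constantCoeff s = 0)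
    (hs0' : constantCoeff s' = 0) {N : ℕ} (hs : ∀ i < N, coeff i s = coeff i s') (hG : η • G.subst s - G = Φ) :
    ∀ n < N, coeff n (η • G.subst s') = coeff n (G + Φ) := by
  intro n hn
  have h := twistSubst_congr_mod η hs0 hs0' hs (G := G) (G' := G) (fun _ _ => rfl) n hn
  rw [hG, map_sub] at h
  rw [map_add]
  linear_combination -h

/-- The same for the two-element form: if `η·G∘s − G = Φ`, `η'·G∘s − G = Φ'` share the substitution `s` (`[β] = [β']` to the
precision considered is the typical use, here exact) then `(η − η')·G∘s = Φ − Φ'` — no `G` outside the substitution. [folklore] -/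
theorem mahler_pair_sub (η η' : k) {s G Φ Φ' : PowerSeries k} (hG : η • G.subst s - G = Φ) (hG' : η' • G.subst s - G = Φ') :
    (η - η') • G.subst s = Φ - Φ' := by
  rw [← hG, ← hG', sub_smul]
  abel

end Summit.BirchSwinnertonDyer.BirchSwinnertonDyer.Theorems.SignedMuAtTwo.SmoothingCoboundary
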